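import Mathlib
import Summits.Ventures.PercRepro2.Defs
import Summits.Ventures.PercRepro2.Independence
import Summits.Ventures.PercRepro2.Harris
import Summits.Ventures.PercRepro2.Graph
import Summits.Ventures.PercRepro2.Exploration
import Summits.Ventures.PercRepro2.Events
import Summits.Ventures.PercRepro2.Induced
import Summits.Ventures.PercRepro2.BoxUnionDefs
import Summits.Ventures.PercRepro2.BoxUnion
import Summits.Ventures.PercRepro2.BoxUnionPair
import Summits.Ventures.PercRepro2.BoxUnionPush
import Summits.Ventures.PercRepro2.BoxUnionPushSub
import Summits.Ventures.PercRepro2.PairTP2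
import Summits.Ventures.PercRepro2.PairTP2Main
import Summits.Ventures.PercRepro2.SeparatedDefs
import Summits.Ventures.PercRepro2.SeparatedPair
import Summits.Ventures.PercRepro2.PairTP2BroomLemmas
import Summits.Ventures.PercRepro2.PairTP2Broom
import Summits.Ventures.PercRepro2.PairTP2BroomGrid
import Summits.Ventures.PercRepro2.PairTP2BroomMass
import Summits.Ventures.PercRepro2.PairTP2BroomExists

/-!
# Corollaries of (PAIR-TP2) (⟹): (Z-LSM) (⟹ b) and the necessity half of (STATUS-LSM)
(blind cell PercRepro2, mine-1 g39; proofs/MINE1-ZLSM.md §3 (⟹ b) and §6.1 (P))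

Down-closure (`BoxUnionPair.pairLaw_lsm_of_subset`) turns the kernel (⟹) of (PAIR-TP2)
(`PairTP2Broom.exists_not_lsm`) into statements about larger observed sets:
* **(STATUS-LSM), necessity (P)**: if the status law on `F` is log-supermodular for every
  admissible weight vector, then every pair `u ≠ v` in `F` off the terminals is not linkable or
  not interfaced (`not_linkable_or_not_interfaced_of_lsm`);
* **(Z-LSM) (⟹ b)**: if some edge `e = {x, y}` off the terminals is linkable (a configuration
  with `s ↮ t`, `x ∈ C_s`, `y ∈ C_t` or the mirror), then the FULL two-cluster law is not
  log-supermodular at some admissible weight vector (`exists_not_lsm_univ_of_linkable_edge`) —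
  an edge is interfaced by itself.
-/

namespace Summit.Ventures.PercRepro2

namespace PairTP2Broom

open Finset
open scoped Classical

variable {V : Type*} {E : Type*} [Fintype V] [DecidableEq V] [Fintype E] [DecidableEq E]
variable (ends : E → Sym2 V) (s t : V) {u v : V}

/-- **(STATUS-LSM), necessity (P), in the kernel**: a status law on `F` that is log-supermodular
for every admissible weight vector has no linkable-and-interfaced pair in `F` off the
terminals. -/
theorem not_linkable_or_not_interfaced_of_lsm {F : Finset V} (hne : u ≠ v)
    (hu : u ∉ ({s, t} : Set V)) (hv : v ∉ ({s, t} : Set V)) (huF : u ∈ F) (hvF : v ∈ F)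
    (h : ∀ p : E → ℝ, IsProbVec p → ∀ x y : BoxUnionPair.ZLat V,
      BoxUnionPair.pairLaw p ends F s t x * BoxUnionPair.pairLaw p ends F s t y ≤
        BoxUnionPair.pairLaw p ends F s t (x ⊓ y) * BoxUnionPair.pairLaw p ends F s t (x ⊔ y)) :
    PairTP2.NotLinkable ends s t u v ∨ v ∉ Separated.comp ends s t u := by
  rw [← pairTP2_iff ends s t hne hu hv]
  intro p hp x y
  have hsub : ({u, v} : Finset V) ⊆ F := by
    intro z hz
    rw [Finset.mem_insert, Finset.mem_singleton] at hz
    rcases hz with rfl | rfl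
    · exact huF
    · exact hvF
  exact BoxUnionPair.pairLaw_lsm_of_subset ends s t hp hsub (h p hp) x y

omit [Fintype V] [DecidableEq V] [Fintype E] [DecidableEq E] in
/-- An edge off the terminals joins its endpoints in `G − {s, t}`. -/
lemma mem_comp_of_edge {e : E} {x y : V} (hxy : ends e = s(x, y)) (hx : x ∉ ({s, t} : Set V))
    (hy : y ∉ ({s, t} : Set V)) : y ∈ Separated.comp ends s t x := by
  show Conn ends (Separated.base ends s t) x y
  refine conn_of_openAdj ⟨e, ?_, hxy⟩
  rw [Separated.base, induced_eq_true_iff]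
  exact ⟨rfl, x, hx, y, hy, hxy⟩

/-- **(Z-LSM) (⟹ b) in the kernel**: a linkable edge `e = {x, y}` off the terminals makes the
status law on every `F ∋ x, y` — in particular the FULL two-cluster law — fail
log-supermodularity at some admissible weight vector. -/
theorem exists_not_lsm_of_linkable_edge {e : E} {x y : V} (hxy : ends e = s(x, y))
    (hne : x ≠ y) (hx : x ∉ ({s, t} : Set V)) (hy : y ∉ ({s, t} : Set V))
    (hlink : ¬ PairTP2.NotLinkable ends s t x y) {F : Finset V} (hxF : x ∈ F) (hyF : y ∈ F) :
    ∃ p : E → ℝ, IsProbVec p ∧ ¬ ∀ a b : BoxUnionPair.ZLat V,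
      BoxUnionPair.pairLaw p ends F s t a * BoxUnionPair.pairLaw p ends F s t b ≤
        BoxUnionPair.pairLaw p ends F s t (a ⊓ b) * BoxUnionPair.pairLaw p ends F s t (a ⊔ b) := by
  obtain ⟨p, hp, hviol⟩ := exists_not_lsm ends s t hx hy hlink (mem_comp_of_edge ends s t hxy hx hy)
  refine ⟨p, hp, fun h => hviol ?_⟩
  have hsub : ({x, y} : Finset V) ⊆ F := by
    intro z hz
    rw [Finset.mem_insert, Finset.mem_singleton] at hz
    rcases hz with rfl | rfl
    · exact hxF
    · exact hyF
  exact fun a b => BoxUnionPair.pairLaw_lsm_of_subset ends s t hp hsub h a b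

/-- **(Z-LSM) (⟹ b), the full law**: a linkable edge off the terminals makes the full
two-cluster law fail log-supermodularity at some admissible weight vector. -/
theorem exists_not_lsm_univ_of_linkable_edge {e : E} {x y : V} (hxy : ends e = s(x, y))
    (hne : x ≠ y) (hx : x ∉ ({s, t} : Set V)) (hy : y ∉ ({s, t} : Set V))
    (hlink : ¬ PairTP2.NotLinkable ends s t x y) :
    ∃ p : E → ℝ, IsProbVec p ∧ ¬ ∀ a b : BoxUnionPair.ZLat V,
      BoxUnionPair.pairLaw p ends univ s t a * BoxUnionPair.pairLaw p ends univ s t b ≤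
        BoxUnionPair.pairLaw p ends univ s t (a ⊓ b) *
          BoxUnionPair.pairLaw p ends univ s t (a ⊔ b) :=
  exists_not_lsm_of_linkable_edge ends s t hxy hne hx hy hlink (Finset.mem_univ x)
    (Finset.mem_univ y)

end PairTP2Broom

end Summit.Ventures.PercRepro2
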